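import Literature.Computability.Complexity.SymmetricThresholdPrograms
import HarnessLib

/-!
# Symmetric threshold programs: counting-comparison gadgets

Reusable GADGETS for symmetric threshold programs (`SymProg`, `SymmetricThresholdPrograms.lean`)
comparing the NUMBERS of true wires in two finite sets of wires `A`, `B` — the arithmetic of
colour refinement ("as many neighbours of colour `c`", "fewer vertices with a smaller key"), of
cell-size selection and of the switching test `|C|·|D| < 2·e(C,D)` of Corneil–Goldberg sections
(route `PneNP/SymmetryBudget`, item `NoHiddenOrder`), done with threshold gates only
(Anderson–Dawar 2017, §3: counting quantifiers by threshold gates):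

* `SymProg.CmpCount P N` names, for ONE comparison, the threshold gates `geA θ = [#A ≥ θ]`,
  `geB θ = [#B ≥ θ]` (`θ ≤ N`), their negations and the combinations
  `eq = ∀ θ, (geA θ ↔ geB θ)`, `lt = ∃ θ, ¬geA θ ∧ geB θ`, with the equations they satisfy in `P`;
  `CmpCount.sem_eq : … ↔ #A = #B` (counts `≤ N`), `CmpCount.sem_lt : … ↔ #A < #B` (`#B ≤ N`).
* `SymProg.CmpTwice P N`: `ge2A θ = [#A ≥ 2θ]`, `tw = ∃ θ ≥ 1, geB θ ∧ ¬ge2A θ`;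
  `CmpTwice.sem_tw : … ↔ #A < 2·#B` (`#B ≤ N`).
Users index families of comparisons by functions into these structures. Gate count `O(N)` each.

## References
* M. Anderson, A. Dawar, *On symmetric circuits and fixed-point logics*, Theory Comput. Syst. 60
  (2017), §3 [AndersonDawar2016].
-/

namespace Literature.Computability.Complexity

open Finset

namespace SymProg

variable {ι Λ : Type*} (P : SymProg ι Λ) (N : ℕ)

/-- The number of true wires of a finite set of wires on input `x`. [folklore] -/
def trueCount (x : ι → Bool) (A : Finset (ι ⊕ Λ)) : ℕ := (A.filter fun w => wval x (P.sem x) w = true).card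

/-- The true count is at most the number of wires. [folklore] -/
theorem trueCount_le_card (x : ι → Bool) (A : Finset (ι ⊕ Λ)) : P.trueCount x A ≤ A.card :=
  Finset.card_filter_le _ _

/-- A threshold gate over `A` reads the true count. [folklore] -/
theorem sem_atLeast_trueCount {x : ι → Bool} {l : Λ} {t : ℕ} {A : Finset (ι ⊕ Λ)}
    (hk : P.kind l = Kind.atLeast t) (hs : P.srcs l = A) : P.sem x l = true ↔ t ≤ P.trueCount x A := by
  rw [P.sem_atLeast hk, hs]; rfl

variable [DecidableEq ι] [DecidableEq Λ]

/-! ### Equality and strict comparison of two counts -/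

/-- **The count-comparison gadget** for one pair of wire sets `A`, `B` with thresholds `θ ≤ N`.
[cite: AndersonDawar2016, §3] -/
structure CmpCount where
  /-- the first set of wires -/
  A : Finset (ι ⊕ Λ)
  /-- the second set of wires -/
  B : Finset (ι ⊕ Λ)
  /-- `geA θ = [#A ≥ θ]` -/
  geA : Fin (N + 1) → Λ
  /-- `geB θ = [#B ≥ θ]` -/
  geB : Fin (N + 1) → Λ
  /-- `ngeA θ = ¬ geA θ` -/
  ngeA : Fin (N + 1) → Λ
  /-- `both θ = geA θ ∧ geB θ` -/
  both : Fin (N + 1) → Λ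
  /-- `none θ = ¬geA θ ∧ ¬geB θ` -/
  none : Fin (N + 1) → Λ
  /-- `eqv θ = (geA θ ↔ geB θ)` -/
  eqv : Fin (N + 1) → Λ
  /-- `eq = ∀ θ, eqv θ` -/
  eq : Λ
  /-- `ltw θ = ¬geA θ ∧ geB θ` -/
  ltw : Fin (N + 1) → Λ
  /-- `lt = ∃ θ, ltw θ` -/
  lt : Λ
  kind_geA : ∀ θ, P.kind (geA θ) = Kind.atLeast θ
  srcs_geA : ∀ θ, P.srcs (geA θ) = A
  kind_geB : ∀ θ, P.kind (geB θ) = Kind.atLeast θ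
  srcs_geB : ∀ θ, P.srcs (geB θ) = B
  kind_ngeA : ∀ θ, P.kind (ngeA θ) = Kind.nor
  srcs_ngeA : ∀ θ, P.srcs (ngeA θ) = {Sum.inr (geA θ)}
  kind_both : ∀ θ, P.kind (both θ) = Kind.and
  srcs_both : ∀ θ, P.srcs (both θ) = {Sum.inr (geA θ), Sum.inr (geB θ)}
  kind_none : ∀ θ, P.kind (none θ) = Kind.nor
  srcs_none : ∀ θ, P.srcs (none θ) = {Sum.inr (geA θ), Sum.inr (geB θ)}
  kind_eqv : ∀ θ, P.kind (eqv θ) = Kind.or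
  srcs_eqv : ∀ θ, P.srcs (eqv θ) = {Sum.inr (both θ), Sum.inr (none θ)}
  kind_eq : P.kind eq = Kind.and
  srcs_eq : P.srcs eq = univ.image fun θ => Sum.inr (eqv θ)
  kind_ltw : ∀ θ, P.kind (ltw θ) = Kind.and
  srcs_ltw : ∀ θ, P.srcs (ltw θ) = {Sum.inr (ngeA θ), Sum.inr (geB θ)}
  kind_lt : P.kind lt = Kind.or
  srcs_lt : P.srcs lt = univ.image fun θ => Sum.inr (ltw θ)

namespace CmpCount

variable {P N} (C : P.CmpCount N) (x : ι → Bool)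

/-- The first count. [folklore] -/
abbrev a : ℕ := P.trueCount x C.A

/-- The second count. [folklore] -/
abbrev b : ℕ := P.trueCount x C.B

/-- `geA`. [folklore] -/
theorem sem_geA (θ : Fin (N + 1)) : P.sem x (C.geA θ) = true ↔ (θ : ℕ) ≤ C.a x :=
  P.sem_atLeast_trueCount (C.kind_geA θ) (C.srcs_geA θ)

/-- `geB`. [folklore] -/
theorem sem_geB (θ : Fin (N + 1)) : P.sem x (C.geB θ) = true ↔ (θ : ℕ) ≤ C.b x :=
  P.sem_atLeast_trueCount (C.kind_geB θ) (C.srcs_geB θ)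

/-- `ngeA`. [folklore] -/
theorem sem_ngeA (θ : Fin (N + 1)) : P.sem x (C.ngeA θ) = true ↔ C.a x < θ := by
  rw [P.sem_nor_singleton (C.kind_ngeA θ) (C.srcs_ngeA θ), wval_inr, Bool.not_eq_true',
    ← Bool.not_eq_true, sem_geA, not_le]

/-- `eqv θ`: the two threshold tests agree. [folklore] -/
theorem sem_eqv (θ : Fin (N + 1)) :
    P.sem x (C.eqv θ) = true ↔ ((θ : ℕ) ≤ C.a x ↔ (θ : ℕ) ≤ C.b x) := by
  rw [P.sem_or (C.kind_eqv θ), C.srcs_eqv]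
  simp only [mem_insert, mem_singleton, exists_eq_or_imp, exists_eq_left, wval_inr]
  rw [P.sem_and (C.kind_both θ), C.srcs_both, P.sem_nor (C.kind_none θ), C.srcs_none]
  simp only [mem_insert, mem_singleton, forall_eq_or_imp, forall_eq, wval_inr]
  rw [← sem_geA, ← sem_geB]
  cases P.sem x (C.geA θ) <;> cases P.sem x (C.geB θ) <;> simp

/-- **`eq`: the two counts are equal** (both at most `N`). [folklore] -/
theorem sem_eq (ha : C.a x ≤ N) (hb : C.b x ≤ N) : P.sem x C.eq = true ↔ C.a x = C.b x := by
  rw [P.sem_and C.kind_eq, C.srcs_eq]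
  simp only [mem_image, mem_univ, true_and, forall_exists_index, forall_apply_eq_imp_iff, wval_inr,
    sem_eqv]
  constructor
  · intro h
    apply le_antisymm
    · have := (h ⟨C.a x, Nat.lt_succ_of_le ha⟩).1 le_rfl
      exact this
    · have := (h ⟨C.b x, Nat.lt_succ_of_le hb⟩).2 le_rfl
      exact this
  · intro h θ; rw [h]

/-- **`lt`: the first count is smaller** (second count at most `N`). [folklore] -/
theorem sem_lt (hb : C.b x ≤ N) : P.sem x C.lt = true ↔ C.a x < C.b x := by
  rw [P.sem_or C.kind_lt, C.srcs_lt]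
  simp only [mem_image, mem_univ, true_and, exists_exists_eq_and, wval_inr]
  have hltw : ∀ θ : Fin (N + 1), P.sem x (C.ltw θ) = true ↔ C.a x < θ ∧ (θ : ℕ) ≤ C.b x := by
    intro θ
    rw [P.sem_and (C.kind_ltw θ), C.srcs_ltw]
    simp only [mem_insert, mem_singleton, forall_eq_or_imp, forall_eq, wval_inr, sem_ngeA, sem_geB]
  simp only [hltw]
  constructor
  · rintro ⟨θ, h1, h2⟩; omega
  · intro h; exact ⟨⟨C.b x, Nat.lt_succ_of_le hb⟩, h, le_rfl⟩

end CmpCount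

/-! ### The switching test: a count against twice another -/

/-- **The "less than twice" gadget**: `tw = [#A < 2·#B]`, by `∃ θ ≥ 1, [#B ≥ θ] ∧ ¬[#A ≥ 2θ]`.
[cite: AndersonDawar2016, §3] -/
structure CmpTwice where
  /-- the first set of wires (e.g. all pairs between two cells) -/
  A : Finset (ι ⊕ Λ)
  /-- the second set of wires (e.g. the adjacent pairs) -/
  B : Finset (ι ⊕ Λ)
  /-- `ge2A θ = [#A ≥ 2θ]` -/
  ge2A : Fin (N + 1) → Λ
  /-- `geB θ = [#B ≥ θ]` -/
  geB : Fin (N + 1) → Λ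
  /-- `nge2A θ = ¬ ge2A θ` -/
  nge2A : Fin (N + 1) → Λ
  /-- `tww θ = geB θ ∧ ¬ ge2A θ` (used for `θ ≥ 1`) -/
  tww : Fin (N + 1) → Λ
  /-- `tw = ∃ θ ≥ 1, tww θ` -/
  tw : Λ
  kind_ge2A : ∀ θ, P.kind (ge2A θ) = Kind.atLeast (2 * θ)
  srcs_ge2A : ∀ θ, P.srcs (ge2A θ) = A
  kind_geB : ∀ θ, P.kind (geB θ) = Kind.atLeast θ
  srcs_geB : ∀ θ, P.srcs (geB θ) = B
  kind_nge2A : ∀ θ, P.kind (nge2A θ) = Kind.nor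
  srcs_nge2A : ∀ θ, P.srcs (nge2A θ) = {Sum.inr (ge2A θ)}
  kind_tww : ∀ θ, P.kind (tww θ) = Kind.and
  srcs_tww : ∀ θ, P.srcs (tww θ) = {Sum.inr (geB θ), Sum.inr (nge2A θ)}
  kind_tw : P.kind tw = Kind.or
  srcs_tw : P.srcs tw = (univ.filter fun θ : Fin (N + 1) => 1 ≤ (θ : ℕ)).image fun θ => Sum.inr (tww θ)

namespace CmpTwice

variable {P N} (C : P.CmpTwice N) (x : ι → Bool)

/-- The first count. [folklore] -/
abbrev a : ℕ := P.trueCount x C.A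

/-- The second count. [folklore] -/
abbrev b : ℕ := P.trueCount x C.B

/-- `tww θ`. [folklore] -/
theorem sem_tww (θ : Fin (N + 1)) : P.sem x (C.tww θ) = true ↔ (θ : ℕ) ≤ C.b x ∧ C.a x < 2 * θ := by
  rw [P.sem_and (C.kind_tww θ), C.srcs_tww]
  simp only [mem_insert, mem_singleton, forall_eq_or_imp, forall_eq, wval_inr]
  rw [P.sem_atLeast_trueCount (C.kind_geB θ) (C.srcs_geB θ),
    P.sem_nor_singleton (C.kind_nge2A θ) (C.srcs_nge2A θ), wval_inr, Bool.not_eq_true',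
    ← Bool.not_eq_true, P.sem_atLeast_trueCount (C.kind_ge2A θ) (C.srcs_ge2A θ), not_le]

/-- **`tw`: the first count is less than twice the second** (second count at most `N`). [folklore] -/
theorem sem_tw (hb : C.b x ≤ N) : P.sem x C.tw = true ↔ C.a x < 2 * C.b x := by
  rw [P.sem_or C.kind_tw, C.srcs_tw]
  simp only [mem_image, mem_filter, mem_univ, true_and]
  constructor
  · rintro ⟨_, ⟨θ, hθ, rfl⟩, h⟩
    rw [wval_inr, sem_tww] at h
    omega
  · intro h
    have hb1 : 1 ≤ C.b x := by omega
    refine ⟨_, ⟨⟨C.b x, Nat.lt_succ_of_le hb⟩, hb1, rfl⟩, ?_⟩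
    rw [wval_inr, sem_tww]
    exact ⟨le_rfl, h⟩

end CmpTwice

end SymProg

end Literature.Computability.Complexity
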